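import Summits.QuantumFields.YangMills.Theorems.BalabanUVNodesN15KingModelTwoSpacingOneDatum
import HarnessLib

/-!
# BalabanUVNodes ∕ N15 — THE KING-MODEL RUNG, CURVED EDITION (PART Ω₂): «FOR 0 < α < 1, AND γ SUFFICIENTLY SMALL» — ONE CONSTANT TRIPLE `(C, δ₀, γ)`
# PER HÖLDER EXPONENT FOR ALL OF KING 1986 §3.3 (PROPS. 3.7, 3.8, 3.9) ON THE ONE TWO-SPACING RECORD `kingTwoSpacingFull` AT `A = 0`,
# via the schema-level MONOTONICITY of the typer's predicates `Prop37PrintedAt` ∕ `Prop38PrintedAt` ∕ `Prop39PrintedAt` in their constants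
# (Track A, DAG node N15 = NE2; FAN-OUT v1.1 §N15 s3 «KING-MODEL RUNG»)

HONEST FRAMING.  Count-neutral kernel bookkeeping (cell `pub-ymgap`, seat `pub-ymgap-dag-n15-e` g23; `--supports stmt-QuantumFields-27366 --as helper`
= K3⁸ `SpineGivenEndpointR13SepCoPHV`).  TEMPLATE LITERATURE, `A = 0`: C. King's scalar U(1)-Higgs MODEL on finite tori ([King1986] §3.3 pp. 663–665);
NOT Bałaban's covariant `G(U)` ∕ `H_k(U)`; NE2⁺ is NOT PRINTED for those and not proved; NOT a node discharge; N15's located burden («non-abelian `G(U)`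
dressing of NE2») untouched; nothing continuum ∕ ℝ⁴ ∕ OS ∕ mass-gap ∕ Clay.  0 `sorry`, 0 `def`; standard axioms.

WHY THIS FILE.  King states Propositions 3.7, 3.8 and 3.9 with ONE constant convention: «For … 0 < α < 1, and γ sufficiently small» (p. 664, p. 665),
`C` generic — at a given Hölder exponent `α` one triple `(C, δ₀, γ)` serves all of (3.63)–(3.65), (3.71), (3.73)–(3.75) simultaneously (that is how
§3.4–§3.5 consume them: one `γ` «sufficiently small» for the whole diagram estimate).  Part Ω₁ (`…TwoSpacingOneDatum`) put the three propositions on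
ONE record `T = kingTwoSpacingFull L a m² j n` with constants uniform in the volume, the scales and the mass — but with one triple PER PROPOSITION
(`prop38PrintedAt_kingTwoSpacingFull_unif`, `prop39PrintedAt_kingTwoSpacingFull_unif`, part Ρ-g `prop37PrintedAt_king_zeroField`).  This file merges
them: §1 the typer's three fixed-exponent predicates are MONOTONE in their constants — a larger `C`, a smaller `δ₀ ≥ 0`, a smaller rate `γ` give
weaker statements (for (3.73)–(3.75) the rate and the slice weight combine to `L^{−γk}(L^jη)^{−γ} = L^{−γj}`, antitone in `γ` because `L ≥ 1`;
`schema_rate_slice_eq`) — generic schema lemmas `prop37PrintedAt_mono`, `prop38PrintedAt_mono`, `prop39PrintedAt_mono` for ANY data of the typer's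
records (any consumer of the three schemas may use them); §2 ★★★ `king_props37_38_39_commonConstants`: for odd `L ≥ 3`, `a > 0`, `m₀² ≥ 0` and every
`0 < α < 1` ONE `(C, δ₀, γ > 0)` with `Prop37PrintedAt α T.lo C δ₀ ∧ Prop37PrintedAt α ((K+n)-run) C δ₀ ∧ Prop38PrintedAt α T C δ₀ γ ∧ Prop39PrintedAt α T C δ₀ γ`
for EVERY volume∕scale index `j`, every `n ≥ 1`, every mass `0 < m² ≤ m₀²` (`T = kingTwoSpacingFull L a m² j n`) — King's quantifier convention for
§3.3 verbatim, in the model at `A = 0`.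

HONEST SCOPE: as part Ω₁ (`A = 0`, periodic b.c., odd `L ≥ 3`, `a > 0`, `K, n ≥ 1`, volumes `2L^m`, `0 < m² ≤ m₀²`, contour sort empty by type); the
family-uniform schemas (`α` INSIDE one constant) are NOT claimed — `(C, δ₀, γ)` depend on `α`, exactly King's order.  The monotonicity lemmas assume only
`1 ≤ L`, non-negative distances and `0 ≤ C`, `0 ≤ δ₀′` — properties of every datum in the tree.
Locators: [King1986] CMP **102** (1986): Prop. 3.7 (3.63)–(3.65) p. 663, Prop. 3.8 (3.71) p. 664 («0 < α < 1, and γ sufficiently small»), Prop. 3.9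
(3.73)–(3.75) p. 665 (same words), (3.14) p. 657 (`η = L^{−k}`), §3.4 p. 664–666 (the consumption).
-/

noncomputable section

namespace Summit.QuantumFields.YangMills.BalabanUVNodes.N15KingModelRung.Curved

open Real Finset
open Literature.MathematicalPhysics.QuantumFieldTheory.Balaban1983to89.B5Prop11Plancherel (Tor fine)
open Literature.MathematicalPhysics.QuantumFieldTheory.King1986.Torus (tdistT tdistT_nonneg)
open Literature.MathematicalPhysics.QuantumFieldTheory.King1986.SlicePropagator (SliceKernels TwoSpacing holderDeriv Prop37PrintedAt
  Prop38PrintedAt Prop39PrintedAt)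
open Summit.QuantumFields.YangMills.BalabanUVNodes.N15KingModelRung (KingVolIndex kingVol kingVol_neZero)

variable {d : ℕ}

/-! ## §1 Schema-level monotonicity of the fixed-exponent predicates in their constants -/

section Mono

variable {dd : ℕ}

/-- Display monotonicity, three factors: `|X| ≤ C·R·E`, `0 ≤ C ≤ C′`, `0 ≤ R ≤ R′`, `0 ≤ E ≤ E′` ⇒ `|X| ≤ C′·R′·E′`. [folklore] -/
theorem display3_mono {X C C' R R' E E' : ℝ} (h : |X| ≤ C * R * E) (hC0 : 0 ≤ C) (hC : C ≤ C') (hR0 : 0 ≤ R) (hR : R ≤ R')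
    (hE0 : 0 ≤ E) (hE : E ≤ E') : |X| ≤ C' * R' * E' :=
  h.trans (mul_le_mul (mul_le_mul hC hR hR0 (hC0.trans hC)) hE hE0 (mul_nonneg (hC0.trans hC) (hR0.trans hR)))

/-- Display monotonicity, four factors with the middle two compared AS A PRODUCT: `|X| ≤ C·A·B·E`, `0 ≤ C ≤ C′`, `0 ≤ A·B ≤ A′·B′`, `0 ≤ E ≤ E′`
⇒ `|X| ≤ C′·A′·B′·E′`. [folklore] -/
theorem display4_mono {X C C' A A' B B' E E' : ℝ} (h : |X| ≤ C * A * B * E) (hC0 : 0 ≤ C) (hC : C ≤ C') (hP0 : 0 ≤ A * B)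
    (hP : A * B ≤ A' * B') (hE0 : 0 ≤ E) (hE : E ≤ E') : |X| ≤ C' * A' * B' * E' := by
  have h' : |X| ≤ C * (A * B) * E := by simpa only [mul_assoc] using h
  have := display3_mono h' hC0 hC hP0 hP hE0 hE
  simpa only [mul_assoc] using this

/-- The decay factor is antitone in the decay rate: `δ₀′ ≤ δ₀`, `0 ≤ D` ⇒ `e^{−δ₀D} ≤ e^{−δ₀′D}`. [folklore] -/
theorem decayFactor_mono {δ₀ δ₀' D : ℝ} (hδ : δ₀' ≤ δ₀) (hD : 0 ≤ D) : Real.exp (-(δ₀ * D)) ≤ Real.exp (-(δ₀' * D)) :=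
  Real.exp_le_exp.2 (neg_le_neg (mul_le_mul_of_nonneg_right hδ hD))

/-- The scaled decay factor is antitone in the decay rate: `δ₀′ ≤ δ₀`, `0 < s`, `0 ≤ D` ⇒ `e^{−δ₀s⁻¹D} ≤ e^{−δ₀′s⁻¹D}`. [folklore] -/
theorem decayFactorSlice_mono {δ₀ δ₀' s D : ℝ} (hδ : δ₀' ≤ δ₀) (hs : 0 < s) (hD : 0 ≤ D) :
    Real.exp (-(δ₀ * s⁻¹ * D)) ≤ Real.exp (-(δ₀' * s⁻¹ * D)) := by
  have h0 : 0 ≤ s⁻¹ * D := mul_nonneg (inv_nonneg.2 hs.le) hD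
  have : δ₀' * s⁻¹ * D ≤ δ₀ * s⁻¹ * D := by
    simpa only [mul_assoc] using mul_le_mul_of_nonneg_right hδ h0
  exact Real.exp_le_exp.2 (neg_le_neg this)

/-- The rate factor `L^{−γk}` is antitone in `γ` for `L ≥ 1`. [folklore] -/
theorem schema_rate_mono (D : SliceKernels dd) (hL : 1 ≤ D.L) {γ γ' : ℝ} (hγ : γ' ≤ γ) :
    (D.L : ℝ) ^ (-(γ * D.k)) ≤ (D.L : ℝ) ^ (-(γ' * D.k)) := by
  have hL1 : (1 : ℝ) ≤ D.L := by exact_mod_cast hL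
  exact Real.rpow_le_rpow_of_exponent_le hL1 (neg_le_neg (mul_le_mul_of_nonneg_right hγ (Nat.cast_nonneg _)))

/-- **The rate-times-slice-weight identity of the schema**: `L^{−γk}·(L^jη)^{e−γ} = (L^j)^{−γ}·(L^jη)^e` (`η = L^{−k}`: the rate `L^{−γk}` and the
weight `(L^jη)^{−γ}` combine to `L^{−γj}`). [cite: King1986, (3.14) p.657 (`η = L^{−k}`), (3.73) p.665] -/
theorem schema_rate_slice_eq (D : SliceKernels dd) (hL : 0 < D.L) (γ e : ℝ) (j : ℕ) :
    (D.L : ℝ) ^ (-(γ * D.k)) * (D.slice j) ^ (e - γ) = ((D.L : ℝ) ^ (j : ℝ)) ^ (-γ) * (D.slice j) ^ e := by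
  have hLr : (0 : ℝ) < D.L := by exact_mod_cast hL
  have hs : D.slice j = (D.L : ℝ) ^ ((j : ℝ) - D.k) := by
    unfold SliceKernels.slice SliceKernels.η Literature.MathematicalPhysics.QuantumFieldTheory.King1986.ContinuumLimit.eps
    rw [Real.rpow_sub hLr, Real.rpow_natCast, Real.rpow_natCast, div_eq_mul_inv]
  rw [hs, ← Real.rpow_mul hLr.le, ← Real.rpow_mul hLr.le, ← Real.rpow_mul hLr.le, ← Real.rpow_add hLr, ← Real.rpow_add hLr]
  congr 1
  ring

/-- **The combined factor `L^{−γk}(L^jη)^{e−γ}` is antitone in `γ`** for `L ≥ 1` (it equals `L^{−γj}(L^jη)^e`). [cite: King1986, (3.73) p.665] -/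
theorem schema_rate_slice_mono (D : SliceKernels dd) (hL : 1 ≤ D.L) {γ γ' : ℝ} (hγ : γ' ≤ γ) (e : ℝ) (j : ℕ) :
    (D.L : ℝ) ^ (-(γ * D.k)) * (D.slice j) ^ (e - γ) ≤ (D.L : ℝ) ^ (-(γ' * D.k)) * (D.slice j) ^ (e - γ') := by
  have hL0 : 0 < D.L := by omega
  have hL1 : (1 : ℝ) ≤ D.L := by exact_mod_cast hL
  have hs : 0 < D.slice j := D.slice_pos hL0 j
  rw [schema_rate_slice_eq D hL0 γ e j, schema_rate_slice_eq D hL0 γ' e j]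
  have hLj : (1 : ℝ) ≤ (D.L : ℝ) ^ (j : ℝ) := Real.one_le_rpow hL1 (Nat.cast_nonneg j)
  exact mul_le_mul_of_nonneg_right (Real.rpow_le_rpow_of_exponent_le hLj (neg_le_neg hγ)) (Real.rpow_nonneg hs.le e)

/-- Non-negativity of the combined factor. [folklore] -/
theorem schema_rate_slice_nonneg (D : SliceKernels dd) (hL : 0 < D.L) (γ e : ℝ) (j : ℕ) :
    0 ≤ (D.L : ℝ) ^ (-(γ * D.k)) * (D.slice j) ^ (e - γ) :=
  mul_nonneg (Real.rpow_nonneg (Nat.cast_nonneg _) _) (Real.rpow_nonneg (D.slice_pos hL j).le _)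

/-- ★ **`Prop37PrintedAt` IS MONOTONE IN ITS CONSTANTS**: for any slice datum with `L ≥ 1` and non-negative distances, (3.63)–(3.65) at `α` with
`(C, δ₀)` imply the same with any `C′ ≥ C ≥ 0` and `0 ≤ δ₀′ ≤ δ₀`.  Generic schema bookkeeping (every consumer of Prop. 3.7 may weaken constants).
[cite: King1986, Prop. 3.7 (3.63)–(3.65) p.663] -/
theorem prop37PrintedAt_mono {D : SliceKernels dd} (hL : 1 ≤ D.L) (hdist : ∀ x y, 0 ≤ D.dist x y)
    (hdbb : ∀ j x b, 0 ≤ D.distBlockBond j x b) {α C C' δ₀ δ₀' : ℝ} (hC0 : 0 ≤ C) (hC : C ≤ C') (hδ : δ₀' ≤ δ₀)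
    (h : Prop37PrintedAt α D C δ₀) : Prop37PrintedAt α D C' δ₀' := by
  intro j hj
  obtain ⟨h1, h2, h3⟩ := h j hj
  have hL0 : 0 < D.L := by omega
  have hs : 0 < D.slice j := D.slice_pos hL0 j
  have hS : ∀ e : ℝ, 0 ≤ (D.slice j) ^ e := fun e => Real.rpow_nonneg hs.le e
  have hE : ∀ {t : ℝ}, 0 ≤ t → Real.exp (-(δ₀ * (D.slice j)⁻¹ * t)) ≤ Real.exp (-(δ₀' * (D.slice j)⁻¹ * t)) :=
    fun ht => decayFactorSlice_mono hδ hs ht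
  refine ⟨fun x y => ⟨?_, fun μ => ?_⟩, fun x b => ?_, fun x y z hxy => ⟨?_, fun μ => ?_⟩⟩
  · exact display3_mono (h1 x y).1 hC0 hC (hS _) le_rfl (Real.exp_nonneg _) (hE (hdist x y))
  · exact display3_mono ((h1 x y).2 μ) hC0 hC (hS _) le_rfl (Real.exp_nonneg _) (hE (hdist x y))
  · exact display3_mono (h2 x b) hC0 hC (hS _) le_rfl (Real.exp_nonneg _) (hE (hdbb j x b))
  · exact display3_mono (h3 x y z hxy).1 hC0 hC (hS _) le_rfl (Real.exp_nonneg _) (hE (le_min (hdist x z) (hdist y z)))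
  · exact display3_mono ((h3 x y z hxy).2 μ) hC0 hC (hS _) le_rfl (Real.exp_nonneg _) (hE (le_min (hdist x z) (hdist y z)))

/-- ★ **`Prop38PrintedAt` IS MONOTONE IN ITS CONSTANTS**: for any two-spacing datum with `L ≥ 1` and non-negative coarse distances, (3.71) at `α` with
`(C, δ₀, γ)` implies (3.71) with any `C′ ≥ C ≥ 0`, `δ₀′ ≤ δ₀`, `γ′ ≤ γ` («γ sufficiently small»: a smaller rate is a weaker claim).
[cite: King1986, Prop. 3.8 (3.71) p.664] -/
theorem prop38PrintedAt_mono {T : TwoSpacing dd} (hL : 1 ≤ T.lo.L) (hdist : ∀ x y, 0 ≤ T.lo.dist x y) {α C C' δ₀ δ₀' γ γ' : ℝ}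
    (hC0 : 0 ≤ C) (hC : C ≤ C') (hδ : δ₀' ≤ δ₀) (hγ : γ' ≤ γ) (h : Prop38PrintedAt α T C δ₀ γ) : Prop38PrintedAt α T C' δ₀' γ' := by
  obtain ⟨h12, h34⟩ := h
  have hR : (T.lo.L : ℝ) ^ (-(γ * T.lo.k)) ≤ (T.lo.L : ℝ) ^ (-(γ' * T.lo.k)) := schema_rate_mono T.lo hL hγ
  have hR0 : 0 ≤ (T.lo.L : ℝ) ^ (-(γ * T.lo.k)) := Real.rpow_nonneg (Nat.cast_nonneg _) _
  have hE : ∀ {t : ℝ}, 0 ≤ t → Real.exp (-(δ₀ * t)) ≤ Real.exp (-(δ₀' * t)) := fun ht => decayFactor_mono hδ ht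
  refine ⟨fun x' z hz => ⟨?_, fun μ => ?_⟩, fun x' y' z hz hxy hpt => ⟨?_, fun μ => ?_⟩⟩
  · exact display3_mono (h12 x' z hz).1 hC0 hC hR0 hR (Real.exp_nonneg _) (hE (hdist _ _))
  · exact display3_mono ((h12 x' z hz).2 μ) hC0 hC hR0 hR (Real.exp_nonneg _) (hE (hdist _ _))
  · exact display3_mono (h34 x' y' z hz hxy hpt).1 hC0 hC hR0 hR (Real.exp_nonneg _) (hE (le_min (hdist _ _) (hdist _ _)))
  · exact display3_mono ((h34 x' y' z hz hxy hpt).2 μ) hC0 hC hR0 hR (Real.exp_nonneg _) (hE (le_min (hdist _ _) (hdist _ _)))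

/-- ★ **`Prop39PrintedAt` IS MONOTONE IN ITS CONSTANTS**: for any two-spacing datum with `L ≥ 1` and non-negative coarse distances, (3.73)–(3.75) at `α`
with `(C, δ₀, γ)` imply the same with any `C′ ≥ C ≥ 0`, `δ₀′ ≤ δ₀`, `γ′ ≤ γ` (the rate `L^{−γk}` and the slice weight `(L^jη)^{−γ}` combine to `L^{−γj}`,
antitone in `γ`). [cite: King1986, Prop. 3.9 (3.73)–(3.75) p.665] -/
theorem prop39PrintedAt_mono {T : TwoSpacing dd} (hL : 1 ≤ T.lo.L) (hdist : ∀ x y, 0 ≤ T.lo.dist x y)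
    (hdbb : ∀ j x b, 0 ≤ T.lo.distBlockBond j x b) {α C C' δ₀ δ₀' γ γ' : ℝ} (hC0 : 0 ≤ C) (hC : C ≤ C') (hδ : δ₀' ≤ δ₀)
    (hγ : γ' ≤ γ) (h : Prop39PrintedAt α T C δ₀ γ) : Prop39PrintedAt α T C' δ₀' γ' := by
  intro j hj
  obtain ⟨h1, h2, h3⟩ := h j hj
  have hL0 : 0 < T.lo.L := by omega
  have hs : 0 < T.lo.slice j := T.lo.slice_pos hL0 j
  have hP : ∀ e : ℝ, (T.lo.L : ℝ) ^ (-(γ * T.lo.k)) * (T.lo.slice j) ^ (e - γ)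
      ≤ (T.lo.L : ℝ) ^ (-(γ' * T.lo.k)) * (T.lo.slice j) ^ (e - γ') := fun e => schema_rate_slice_mono T.lo hL hγ e j
  have hP0 : ∀ e : ℝ, 0 ≤ (T.lo.L : ℝ) ^ (-(γ * T.lo.k)) * (T.lo.slice j) ^ (e - γ) := fun e => schema_rate_slice_nonneg T.lo hL0 γ e j
  have hE : ∀ {t : ℝ}, 0 ≤ t → Real.exp (-(δ₀ * (T.lo.slice j)⁻¹ * t)) ≤ Real.exp (-(δ₀' * (T.lo.slice j)⁻¹ * t)) :=
    fun ht => decayFactorSlice_mono hδ hs ht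
  refine ⟨fun x' y' => ⟨?_, fun μ => ?_⟩, fun x' b' => ?_, fun x' y' z' hxy hpt => ⟨?_, fun μ => ?_⟩⟩
  · exact display4_mono (h1 x' y').1 hC0 hC (hP0 _) (hP _) (Real.exp_nonneg _) (hE (hdist _ _))
  · exact display4_mono ((h1 x' y').2 μ) hC0 hC (hP0 _) (hP _) (Real.exp_nonneg _) (hE (hdist _ _))
  · exact display4_mono (h2 x' b') hC0 hC (hP0 _) (hP _) (Real.exp_nonneg _) (hE (hdbb _ _ _))
  · exact display4_mono (h3 x' y' z' hxy hpt).1 hC0 hC (hP0 _) (hP _) (Real.exp_nonneg _)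
      (decayFactor_mono hδ (le_min (hdist _ _) (hdist _ _)))
  · exact display4_mono ((h3 x' y' z' hxy hpt).2 μ) hC0 hC (hP0 _) (hP _) (Real.exp_nonneg _)
      (decayFactor_mono hδ (le_min (hdist _ _) (hdist _ _)))

end Mono

/-! ## §2 One `(C, δ₀, γ)` per Hölder exponent for Propositions 3.7, 3.8, 3.9 on the one record -/

variable (L : ℕ) [NeZero L]

/-- The record's coarse distance is non-negative (`|x − y|∕L^K`). [folklore] -/
theorem kingTwoSpacingFull_lodist_nonneg (a msq : ℝ) (j : KingVolIndex d) (n : ℕ) (x y : Tor (fine (L ^ j.K) (kingVol L j))) :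
    0 ≤ (kingTwoSpacingFull L a msq j n).lo.dist x y := by
  haveI := kingVol_neZero L j
  exact div_nonneg (tdistT_nonneg _ _ _) (pow_nonneg (Nat.cast_nonneg _) _)

/-- ★★★ **KING's §3.3 CONSTANT CONVENTION, BY NAME, AT `A = 0`: «for 0 < α < 1, and γ sufficiently small» — ONE `(C, δ₀, γ)` FOR PROPOSITIONS 3.7, 3.8
AND 3.9 ON THE ONE RECORD, UNIFORMLY.**  For odd `L ≥ 3`, `a > 0`, `m₀² ≥ 0` and every Hölder exponent `0 < α < 1` there are `C, δ₀, γ > 0` such that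
for EVERY volume∕scale index `j` (volume `2L^{j.m}`, `K = j.K ≥ 1`), EVERY `n ≥ 1` and EVERY mass `0 < m² ≤ m₀²`, with `T = kingTwoSpacingFull L a m² j n`:
`Prop37PrintedAt α T.lo C δ₀` (Prop. 3.7 for the coarse run's slices) ∧ `Prop37PrintedAt α ((K+n)-run's slices) C δ₀` ∧ `Prop38PrintedAt α T C δ₀ γ`
(Prop. 3.8, all four lines of (3.71)) ∧ `Prop39PrintedAt α T C δ₀ γ` (Prop. 3.9, (3.73)∕(3.75)).  ASSEMBLY: part Ρ-g `prop37PrintedAt_king_zeroField`,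
part Ω₁ `prop38PrintedAt_kingTwoSpacingFull_unif` (dag-n15-d part 54 by name) and `prop39PrintedAt_kingTwoSpacingFull_unif`, merged by §1's
monotonicity (`C := C₇ + C₈ + C₉`, `δ₀ := min`, `γ := min`).  King's `A = 0` MODEL only.
[cite: King1986, Prop. 3.7 p.663, Prop. 3.8 (3.71) p.664, Prop. 3.9 (3.73)–(3.75) p.665] -/
theorem king_props37_38_39_commonConstants (hLodd : Odd L) (hL : 2 ≤ L) {a : ℝ} (ha : 0 < a) {m0sq : ℝ} (hm0 : 0 ≤ m0sq)
    {α : ℝ} (hα0 : 0 < α) (hα1 : α < 1) :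
    ∃ C δ₀ γ : ℝ, 0 < C ∧ 0 < δ₀ ∧ 0 < γ ∧ ∀ (msq : ℝ) (_hm : 0 < msq) (_hcap : msq ≤ m0sq) (j : KingVolIndex d) (n : ℕ) (_hn : 1 ≤ n),
      haveI := kingVol_neZero L j
      Prop37PrintedAt α (kingTwoSpacingFull L a msq j n).lo C δ₀ ∧
      Prop37PrintedAt α (kingSliceKernels L (j.K + n) j.m (kingVol L j) (fun _ => rfl) (one_le_add_of_one_le j.one_le_K n) a msq) C δ₀ ∧
      Prop38PrintedAt α (kingTwoSpacingFull L a msq j n) C δ₀ γ ∧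
      Prop39PrintedAt α (kingTwoSpacingFull L a msq j n) C δ₀ γ := by
  obtain ⟨C₇, δ₇, hC₇, hδ₇, H₇⟩ := prop37PrintedAt_king_zeroField (d := d) L hLodd hL ha hm0 hα0 hα1
  obtain ⟨C₈, δ₈, γ₈, hC₈, hδ₈, hγ₈, H₈⟩ := prop38PrintedAt_kingTwoSpacingFull_unif (d := d) L hLodd hL ha hm0 hα0 hα1
  obtain ⟨C₉, δ₉, γ₉, hC₉, hδ₉, hγ₉, H₉⟩ := prop39PrintedAt_kingTwoSpacingFull_unif (d := d) L hLodd hL ha hm0 hα0 hα1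
  have hL1 : 1 ≤ L := by omega
  refine ⟨C₇ + C₈ + C₉, min δ₇ (min δ₈ δ₉), min γ₈ γ₉, by positivity, lt_min hδ₇ (lt_min hδ₈ hδ₉), lt_min hγ₈ hγ₉,
    fun msq hm hcap j n hn => ?_⟩
  haveI := kingVol_neZero L j
  refine ⟨?_, ?_, ?_, ?_⟩
  · exact prop37PrintedAt_mono (D := (kingTwoSpacingFull L a msq j n).lo) hL1 (kingTwoSpacingFull_lodist_nonneg L a msq j n)
      (fun _ _ b => nomatch b) hC₇.le (by linarith) (min_le_left _ _)
      (H₇ j.K j.m j.one_le_K (kingVol L j) (fun _ => rfl) msq hm hcap)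
  · exact prop37PrintedAt_mono (D := kingSliceKernels L (j.K + n) j.m (kingVol L j) (fun _ => rfl) (one_le_add_of_one_le j.one_le_K n) a msq)
      hL1 (fun x y => div_nonneg (tdistT_nonneg _ _ _) (pow_nonneg (Nat.cast_nonneg _) _)) (fun _ _ b => nomatch b) hC₇.le
      (by linarith) (min_le_left _ _)
      (H₇ (j.K + n) j.m (one_le_add_of_one_le j.one_le_K n) (kingVol L j) (fun _ => rfl) msq hm hcap)
  · exact prop38PrintedAt_mono (T := kingTwoSpacingFull L a msq j n) hL1 (kingTwoSpacingFull_lodist_nonneg L a msq j n) hC₈.le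
      (by linarith) ((min_le_right _ _).trans (min_le_left _ _)) (min_le_left _ _) (H₈ msq hm hcap j n hn)
  · exact prop39PrintedAt_mono (T := kingTwoSpacingFull L a msq j n) hL1 (kingTwoSpacingFull_lodist_nonneg L a msq j n)
      (fun _ _ b => nomatch b) hC₉.le (by linarith) ((min_le_right _ _).trans (min_le_right _ _)) (min_le_right _ _)
      (H₉ msq hm hcap j n hn)

/-- The print-order shape with ONE triple for Propositions 3.8 and 3.9 on each record of the family (`Prop38KingOrder ∧ Prop39KingOrder` with a COMMON
witness per `α`): for `T = kingTwoSpacingFull L a m² j n`, `∀ 0 < α < 1, ∃ C δ₀ γ, 0 < γ ∧ Prop38PrintedAt α T C δ₀ γ ∧ Prop39PrintedAt α T C δ₀ γ`.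
[cite: King1986, Prop. 3.8 p.664, Prop. 3.9 p.665 («0 < α < 1, and γ sufficiently small»)] -/
theorem king_props38_39_kingOrder_common (hLodd : Odd L) (hL : 2 ≤ L) {a : ℝ} (ha : 0 < a) {m0sq : ℝ} (hm0 : 0 ≤ m0sq)
    (j : KingVolIndex d) {n : ℕ} (hn : 1 ≤ n) {msq : ℝ} (hmsq : 0 < msq) (hcap : msq ≤ m0sq) :
    ∀ α : ℝ, 0 < α → α < 1 → ∃ C δ₀ γ : ℝ, 0 < γ ∧
      Prop38PrintedAt α (kingTwoSpacingFull L a msq j n) C δ₀ γ ∧ Prop39PrintedAt α (kingTwoSpacingFull L a msq j n) C δ₀ γ := by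
  intro α hα0 hα1
  obtain ⟨C, δ₀, γ, _, _, hγ, H⟩ := king_props37_38_39_commonConstants (d := d) L hLodd hL ha hm0 hα0 hα1
  exact ⟨C, δ₀, γ, hγ, (H msq hmsq hcap j n hn).2.2.1, (H msq hmsq hcap j n hn).2.2.2⟩

end Summit.QuantumFields.YangMills.BalabanUVNodes.N15KingModelRung.Curved

end
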